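import Summits.BirchSwinnertonDyer.BirchSwinnertonDyer.Theorems.PrintX11aUpperNonSurjThreeSharpNakayama
import Summits.BirchSwinnertonDyer.BirchSwinnertonDyer.Theorems.SmallImageMuTransferMuTransferX9TopGenerator
import Literature.NumberTheory.EllipticCurves.SelmerInftyTorsionFiniteProofs
import Literature.NumberTheory.EllipticCurves.KummerSelmerStructure
import HarnessLib

/-!
# Route `PrintX11a`, child crux U3 = `PrintX11a.UpperNonSurjThree` (item stmt-BirchSwinnertonDyer-20613),
# line «finemu3», stub `FineMu.stub_conjA_three` — the ♯0 criterion PROVED as a THEOREM on the small-image locus: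
# «`R♯(E,p) = 0 ⟹ Sel₀(ℚ_∞, E[p^∞]) = 0 ⟹ (A)`», where `R♯(E,p)` is the LEVEL-0 residual group
# `{y ∈ H¹(ℚ, E[p]) : res_{ℚ_∞} y ↦ Sel₀(ℚ_∞, E[p^∞])}` (cell `bsd-print-x11a`, width seat `bsd-line-x11a-p1-w2`,
# LEAD brief 2026-08-28T05:17:56Z; `--supports` 20613; closes nothing)

HONEST FRAMING.  BSD is not proved by any of this; nothing is asserted about any curve; the crux and its stub
`stub_conjA_three` (statement (A) CLASS-WIDE on U3) stay OPEN.  THEOREMS ONLY (no definition, no named fact, no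
`sorry`), all PROVED from tree theorems.  What a record must still DISPLAY per pair is the certificate
«`R♯(E,p) = 0`» (a finite computation in the class field theory of `ℚ(E[p])`, critic idea-crit-10 (P2)); this
file turns that certificate into statement (A) with NO further input — in particular WITHOUT Deo–Ray–Sujatha's
local hypothesis (c3), which fails on the U3 domain.

WHAT.  The line card's ♯-criterion (Lines/finemu3.md, price (P2)): on a pair with `E[p]` irreducible and
`ρ̄_{E,p}` not onto, `Sel₀♯(ℚ_∞) ⊇ Sel₀(ℚ_∞, E[p^∞])[p]` and «♯0: `R♯(E,p) := Sel₀♯(ℚ_∞)^Γ = 0 ⟹ Sel₀♯ = 0 ⟹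
X₀ = 0 ⟹ (A)`».  The sibling file `…SharpNakayama` proved the Iwasawa half («no `Γ`-fixed `p`-torsion in `Sel₀` ⟹
`Sel₀ = 0`»).  THIS FILE proves the descent half and assembles the criterion, for `E/ℚ` with `E[p]` IRREDUCIBLE and
`ρ̄_{E,p}` NOT SURJECTIVE (the finemu3/finemu5 domain; any prime `p`, any reduction type):

* §1 (any field, any subgroup `H ≤ Γ_K`): if `E[p^∞]^H = 0` then `ι : H¹(H, E[p]) → H¹(H, E[p^∞])` is INJECTIVE
  (a kernel class is `[∂b]` with `p·b ∈ E[p^∞]^H`, Greenberg LNM 1716 §3; `torsionToPrimaryH1Sub_injective_of_…`),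
  and `E[p]^H = 0 ⟹ E[p^∞]^H = 0` (multiply a fixed `p`-primary point down into `E[p]`).
* §2 (over `ℚ`): `E[p]` irreducible ⟹ `E[p]^{Γ_ℚ} = 0` (a fixed point spans a stable line; `#E[p] = p²`); with
  `ρ̄` not onto, `(ρ̄, κ) : Γ_ℚ ↠ ρ̄(Γ_ℚ) × ℤ_p` (tree, Serre Prop. 15: `p ∤ #ρ̄(Γ_ℚ)`, so `ℚ(E[p]) ∩ ℚ_∞ = ℚ`) gives
  `E[p]^{Gal(ℚ̄/ℚ_∞)} = 0` for EVERY `ℤ_p`-extension datum `κ`.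
* §3 THE ♯0 THEOREM (`conjAAt_of_irr_of_not_surj_of_sharpResidual_eq_zero`): if for every cyclotomic `κ` every
  `y ∈ H¹(ℚ, E[p])` (`discreteH1 Γ_ℚ E[p]`) whose restriction to `ℚ_∞`, pushed to `E[p^∞]`-coefficients, lies in
  `Sel₀(ℚ_∞, E[p^∞])` is ZERO, then statement (A) `Rank1Residual.ConjAAt W p` holds (indeed
  `Sel₀(ℚ_∞, E[p^∞]) = 0`, `Rank1Residual.FineSelmerTrivialAt`).  Chain: a `conj_γ`-fixed `p`-torsion class
  `s ∈ Sel₀` lifts to `x ∈ H¹(ℚ_∞, E[p])` (Kummer, tree `exists_torsionToPrimaryH1Sub_eq`); by §1–§2 `ι` is injective,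
  so `x` is `conj_γ`-fixed (naturality `conjH1_torsionToPrimaryH1Sub`); by the tree's DESCENT theorem
  `ZpDescent.exists_resSubgroup_eq_of_conjH1_eq` (Greenberg §3 Lemma 3.2 for finite `p`-torsion coefficients, proved)
  `x = res y` with `y ∈ H¹(ℚ, E[p])`; the certificate gives `y = 0`, so `s = 0`; then `…SharpNakayama`.
* §4 the door on the route's domain `ClassX11a W p ∧ ¬ Surj W p`.

So on U3/U5 the (A)-road's per-pair input is EXACTLY the vanishing of the finite level-0 group `R♯(E,p)`; its
translation into local class-field-theoretic conditions at the primes of `ℚ(E[p])` over `S` (the engine's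
formula; critic (P2) «A_w») is the recorder's/REF's business and is not restated in the kernel.

References: [GreenbergLNM1716] §3 Lemmas 3.1–3.2 (Kummer lift, `Coker(h_n) = 0`), §1 p. 60; [CoatesSujatha2005] §3
statement (A); [Serre1972] §2.4 Prop. 15; [SerreGaloisCohomology1997] I.§2.6 (b) (inflation–restriction);
[DeoRaySujatha2023] §3 (c1)–(c3), Thm. 3.9; [LimSujatha2018] §3; line card Lines/finemu3.md (P2).
-/

set_option linter.dupNamespace false
set_option autoImplicit false

noncomputable section

open scoped Classical

open WeierstrassCurve Field
  Literature.NumberTheory.EllipticCurves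
  Literature.NumberTheory.EllipticCurves.Rank1Residual
  Literature.NumberTheory.GaloisRepresentations
  Summit.BirchSwinnertonDyer.Rank1Residual
  Summit.BirchSwinnertonDyer.BirchSwinnertonDyer.Rank1Residual

namespace Summit.BirchSwinnertonDyer.BirchSwinnertonDyer.Theorems.UpperNonSurjThreeSharp

universe u

/-! ### §1 Any field: `E[p^∞]^H = 0` ⟹ `H¹(H, E[p]) → H¹(H, E[p^∞])` injective; `E[p]^H = 0 ⟹ E[p^∞]^H = 0` -/

section AnyField

variable {K : Type u} [Field K] (W : WeierstrassCurve K) (p : ℕ) (H : Subgroup (absoluteGaloisGroup K))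

/-- **`ι : H¹(H, E[p]) → H¹(H, E[p^∞])` is injective when `E[p^∞]` has no non-zero `H`-fixed point.**  A
kernel class is the class of `σ ↦ σ•b − b` with `b ∈ E[p^∞]` and `p·b` fixed by `H` (the Kummer kernel
`E(L)[p^∞]/p`, `L = K̄^H`); if `E[p^∞]^H = 0` then `p·b = 0`, `b ∈ E[p]`, and the class is a coboundary already in
`E[p]`-cohomology.  Same cocycle bookkeeping as the tree's `finite_ker_torsionToPrimaryH1Sub`.
[cite: GreenbergLNM1716, §3 proof of Lemma 3.1 (`B = E(F_∞)[p^∞]`)] -/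
theorem torsionToPrimaryH1Sub_injective_of_fixedPoints_eq_zero
    (hB : ∀ c : geomPrimaryTorsion W p, (∀ σ : H, σ • c = c) → c = 0) :
    Function.Injective (W.torsionToPrimaryH1Sub p H) := by
  refine (injective_iff_map_eq_zero _).mpr fun x hx ↦ ?_
  obtain ⟨φ, rfl⟩ := oneCocycleClass_surjective _ x
  rw [torsionToPrimaryH1Sub_oneCocycleClass, oneCocycleClass_eq_zero_iff] at hx
  obtain ⟨b, hb⟩ := hx
  let incl := AddSubgroup.inclusion (geomTorsion_le_geomPrimaryTorsion W p)
  have hb' : ∀ σ : H, incl (φ.1 σ) = σ • b - b := fun σ ↦ hb σ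
  -- `p • b` is `H`-fixed, hence zero
  have hadm : ∀ σ : H, σ • (p • b) = p • b := fun σ ↦ by
    have h1 : p • (σ • b - b) = 0 := by
      rw [← hb' σ, ← map_nsmul]
      have : p • φ.1 σ = 0 := Subtype.ext (by
        rw [AddSubgroupClass.coe_nsmul, ZeroMemClass.coe_zero]
        exact AddSubgroup.torsionBy.nsmul_iff.mp (φ.1 σ).2)
      rw [this, map_zero]
    rw [smul_sub, smul_comm, sub_eq_zero] at h1
    exact h1
  have hpb : p • b = 0 := hB (p • b) hadm
  -- so `b ∈ E[p]`
  have hbmem : ((b : geomPrimaryTorsion W p) : geomPoints W) ∈ geomTorsion W (p : ℤ) :=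
    AddSubgroup.torsionBy.nsmul_iff.mpr (by
      rw [← AddSubgroupClass.coe_nsmul, hpb, ZeroMemClass.coe_zero])
  let e : geomTorsion W (p : ℤ) := ⟨_, hbmem⟩
  rw [oneCocycleClass_eq_zero_iff]
  refine ⟨e, fun σ ↦ ?_⟩
  apply AddSubgroup.inclusion_injective (geomTorsion_le_geomPrimaryTorsion W p)
  change incl (φ.1 σ) = incl (σ • e - e)
  rw [hb' σ, map_sub]
  congr 1

/-- **`E[p]^H = 0 ⟹ E[p^∞]^H = 0`**: a non-zero `H`-fixed point of `E[p^∞]` of order `p^{n+1}` has the non-zero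
`H`-fixed multiple `p^n·c ∈ E[p]`; induction on the exponent. [cite: GreenbergLNM1716, §3 (Lemma 3.1, `B = E(F_∞)[p^∞]`)] -/
theorem geomPrimaryTorsion_fixed_eq_zero_of_geomTorsion_fixed_eq_zero
    (hE : ∀ P : geomTorsion W (p : ℤ), (∀ σ : H, (σ : absoluteGaloisGroup K) • P = P) → P = 0)
    (c : geomPrimaryTorsion W p) (hc : ∀ σ : H, σ • c = c) : c = 0 := by
  obtain ⟨n, hn⟩ := c.2
  have hpn : p ^ n • c = 0 := Subtype.ext (by
    rw [AddSubgroupClass.coe_nsmul, ZeroMemClass.coe_zero, ← hn])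
  clear hn
  induction n generalizing c with
  | zero => simpa using hpn
  | succ n ih =>
    -- `d = p^n • c` is `p`-torsion and `H`-fixed, hence in `E[p]^H = 0`
    have hd : p • (p ^ n • c) = 0 := by rw [← mul_nsmul', ← pow_succ', hpn]
    have hdfix : ∀ σ : H, σ • (p ^ n • c) = p ^ n • c := fun σ ↦ by rw [smul_comm, hc σ]
    have hdmem : (((p ^ n • c : geomPrimaryTorsion W p)) : geomPoints W) ∈ geomTorsion W (p : ℤ) :=
      AddSubgroup.torsionBy.nsmul_iff.mpr (by
        rw [← AddSubgroupClass.coe_nsmul, hd, ZeroMemClass.coe_zero])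
    have hP0 : (⟨_, hdmem⟩ : geomTorsion W (p : ℤ)) = 0 := by
      refine hE _ fun σ ↦ Subtype.ext ?_
      change (σ : absoluteGaloisGroup K) • (((p ^ n • c : geomPrimaryTorsion W p)) : geomPoints W) =
        (((p ^ n • c : geomPrimaryTorsion W p)) : geomPoints W)
      rw [← primaryComponent.coe_smul, ← Subgroup.smul_def, hdfix σ]
    have hval : ((p ^ n • c : geomPrimaryTorsion W p) : geomPoints W) = 0 := congrArg Subtype.val hP0
    have hpn' : p ^ n • c = 0 := Subtype.ext hval
    exact ih c hc hpn'

end AnyField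

/-! ### §2 Over `ℚ`: irreducible `E[p]` has no `Γ_ℚ`-fixed point; with `ρ̄` not onto, none fixed by `Gal(ℚ̄/ℚ_∞)` -/

section OverQ

variable (W : WeierstrassCurve ℚ) [W.IsElliptic] (p : ℕ) [Fact p.Prime]

/-- **`E[p]` irreducible ⟹ `E[p]^{Γ_ℚ} = 0`.**  A `Γ_ℚ`-fixed point `P` spans a `Γ_ℚ`-stable subgroup `ℤ·P`,
which is `0` or all of `E[p]`; the latter is impossible since `#E[p] = p²` (tree `natCard_geomTorsion`) while
`#ℤ·P ∣ p`. [cite: Serre1972, §2 (irreducible = no stable line)] [cite: SilvermanAEC2009, Cor. III.6.4 (`E[p] ≅ (ℤ/p)²`)] -/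
theorem geomTorsion_eq_zero_of_forall_smul_eq (hirr : W.HasIrreducibleModPGaloisRep p)
    (P : geomTorsion W (p : ℤ)) (hP : ∀ σ : absoluteGaloisGroup ℚ, σ • P = P) : P = 0 := by
  have hp : p.Prime := Fact.out
  set L : AddSubgroup (geomTorsion W (p : ℤ)) := AddSubgroup.zmultiples P with hL
  have hstab : ∀ σ : absoluteGaloisGroup ℚ, ∀ Q ∈ L, σ • Q ∈ L := by
    intro σ Q hQ
    obtain ⟨k, rfl⟩ := AddSubgroup.mem_zmultiples_iff.mp hQ
    rw [smul_comm, hP]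
    exact AddSubgroup.zsmul_mem_zmultiples P k
  rcases hirr L hstab with h | h
  · have hPL : P ∈ L := AddSubgroup.mem_zmultiples P
    rw [h] at hPL
    exact (AddSubgroup.mem_bot).mp hPL
  · exfalso
    -- `#L = addOrderOf P ∣ p` but `#E[p] = p²`
    have hcardL : Nat.card L = addOrderOf P := Nat.card_zmultiples P
    have hpP : p • P = 0 := AddSubgroup.torsionBy.nsmul P
    have hdvd : addOrderOf P ∣ p := addOrderOf_dvd_of_nsmul_eq_zero hpP
    have htop : Nat.card L = Nat.card (geomTorsion W (p : ℤ)) := by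
      rw [h]; exact AddSubgroup.card_top
    have hcard : Nat.card (geomTorsion W (p : ℤ)) = p ^ 2 := by
      have := natCard_geomTorsion W (n := (p : ℤ)) (by exact_mod_cast hp.ne_zero)
      simpa using this
    have hle : addOrderOf P ≤ p := Nat.le_of_dvd hp.pos hdvd
    have : p ^ 2 ≤ p := by
      calc p ^ 2 = addOrderOf P := by rw [← hcard, ← htop, hcardL]
        _ ≤ p := hle
    have hp2 : 2 ≤ p := hp.two_le
    nlinarith

/-- **`E[p]` irreducible and `ρ̄_{E,p}` not onto ⟹ `E(ℚ_∞)[p] = 0` for EVERY `ℤ_p`-extension datum `κ`**: a point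
fixed by `Gal(ℚ̄/ℚ_∞) = ker κ` is fixed by all of `Γ_ℚ`, because every `τ ∈ Γ_ℚ` acts on `E[p]` like some
`σ ∈ ker κ` (tree: `(ρ̄, κ)` jointly onto, from Serre's Prop. 15 `p ∤ #ρ̄(Γ_ℚ)`), and then §2's first lemma applies.
The (c1)-type input «`ℚ(E[p]) ∩ ℚ_∞ = ℚ`» of the ♯-criterion. [cite: Serre1972, §2.4 Prop. 15] [cite: DeoRaySujatha2023, §3 (c1) and Lemma 5.1] -/
theorem geomTorsion_eq_zero_of_forall_kerSubgroup_smul_eq (hirr : W.HasIrreducibleModPGaloisRep p)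
    (hns : ¬ W.HasSurjectiveModNGaloisRep p) (κ : ZpExtension ℚ p) (P : geomTorsion W (p : ℤ))
    (hP : ∀ σ ∈ κ.kerSubgroup, σ • P = P) : P = 0 := by
  refine geomTorsion_eq_zero_of_forall_smul_eq W p hirr P fun τ ↦ ?_
  obtain ⟨σ, hστ, hσ1⟩ :=
    exists_galoisRepTorsion_eq_and_eq_of_irreducible_of_not_surjective W p κ hirr hns τ 1
  have hσ : σ ∈ κ.kerSubgroup := ZpExtension.mem_kerSubgroup.mpr hσ1
  rw [← galoisRepTorsion_apply, ← hστ, galoisRepTorsion_apply]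
  exact hP σ hσ

/-- Hence `E[p^∞]` has no non-zero point fixed by `Gal(ℚ̄/ℚ_∞)` (subgroup form, as consumed by §1).
[cite: GreenbergLNM1716, §3 (Lemma 3.1)] [cite: Serre1972, §2.4 Prop. 15] -/
theorem geomPrimaryTorsion_kerSubgroup_fixed_eq_zero (hirr : W.HasIrreducibleModPGaloisRep p)
    (hns : ¬ W.HasSurjectiveModNGaloisRep p) (κ : ZpExtension ℚ p) (c : geomPrimaryTorsion W p)
    (hc : ∀ σ : κ.kerSubgroup, σ • c = c) : c = 0 :=
  geomPrimaryTorsion_fixed_eq_zero_of_geomTorsion_fixed_eq_zero W p κ.kerSubgroup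
    (fun P hP ↦ geomTorsion_eq_zero_of_forall_kerSubgroup_smul_eq W p hirr hns κ P
      fun σ hσ ↦ hP ⟨σ, hσ⟩) c hc

/-! ### §3 The ♯0 theorem: `R♯(E,p) = 0` ⟹ no `Γ`-fixed `p`-torsion in `Sel₀` ⟹ `Sel₀ = 0` ⟹ (A) -/

/-- **Descent half of ♯0.**  For `E/ℚ` with `E[p]` irreducible and `ρ̄_{E,p}` not onto: if for every cyclotomic
`ℤ_p`-extension datum `κ` every level-0 class `y ∈ H¹(ℚ, E[p])` whose restriction to `ℚ_∞` lands (in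
`E[p^∞]`-coefficients) in `Sel₀(ℚ_∞, E[p^∞])` vanishes — «`R♯(E,p) = 0`» — then for every cyclotomic `κ` and
topological generator `γ` the only `conj_γ`-fixed `p`-torsion class of `Sel₀(ℚ_∞, E[p^∞])` is `0`.  Kummer lift,
injectivity of `ι` (§1–§2), descent `ZpDescent.exists_resSubgroup_eq_of_conjH1_eq`.  PROVED, no named fact.
[cite: GreenbergLNM1716, §3 Lemmas 3.1–3.2] [cite: SerreGaloisCohomology1997, I.§2.6 (b)] -/
theorem forall_pTorsion_fixed_eq_zero_of_sharpResidual_eq_zero (hirr : W.HasIrreducibleModPGaloisRep p)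
    (hns : ¬ W.HasSurjectiveModNGaloisRep p)
    (hcert : ∀ κ : ZpExtension ℚ p, κ.IsCyclotomic →
      ∀ y : discreteH1 (absoluteGaloisGroup ℚ) (geomTorsion W (p : ℤ)),
        W.torsionToPrimaryH1Sub p κ.kerSubgroup
            (ResKernel.resSubgroup κ.kerSubgroup (geomTorsion W (p : ℤ)) y) ∈ W.fineSelmerInfty κ →
          y = 0) :
    ∀ (κ : ZpExtension ℚ p) (γ : absoluteGaloisGroup ℚ), κ.IsCyclotomic → κ.IsTopGenerator γ →
      ∀ s ∈ W.fineSelmerInfty κ, p • s = 0 → W.conjH1 p κ.kerSubgroup γ s = s → s = 0 := by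
  intro κ γ hκ hγ s hs hps hfix
  have hp : p.Prime := Fact.out
  -- finiteness / continuity of `E[p]`
  haveI : Finite (geomTorsion W (p : ℤ)) :=
    finite_torsionPoints_holds W (AlgebraicClosure ℚ) (by exact_mod_cast hp.ne_zero)
  haveI : ContinuousSMul (absoluteGaloisGroup ℚ) (geomTorsion W (p : ℤ)) :=
    continuousSMul_geomTorsion W (isOpen_stabilizer_point_holds W) _
  have hstab : ∀ v : geomTorsion W (p : ℤ),
      IsOpen ((MulAction.stabilizer (absoluteGaloisGroup ℚ) v : Subgroup _) :
        Set (absoluteGaloisGroup ℚ)) := fun v ↦ by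
    have : ((MulAction.stabilizer (absoluteGaloisGroup ℚ) v : Subgroup _) :
        Set (absoluteGaloisGroup ℚ)) = (fun g : absoluteGaloisGroup ℚ ↦ g • v) ⁻¹' {v} := by
      ext g; simp [MulAction.mem_stabilizer_iff]
    rw [this]
    exact (isOpen_discrete ({v} : Set (geomTorsion W (p : ℤ)))).preimage
      (continuous_id.smul continuous_const)
  have hpM : ∀ m : geomTorsion W (p : ℤ), p • m = 0 := fun m ↦ AddSubgroup.torsionBy.nsmul m
  -- Kummer lift of `s`
  obtain ⟨x, hx⟩ := W.exists_torsionToPrimaryH1Sub_eq p (H := κ.kerSubgroup)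
    W.zsmul_geomPoints_surjective_holds hps
  -- `ι` is injective, so `x` is `conj_γ`-fixed
  have hinj := torsionToPrimaryH1Sub_injective_of_fixedPoints_eq_zero W p κ.kerSubgroup
    (geomPrimaryTorsion_kerSubgroup_fixed_eq_zero W p hirr hns κ)
  have hxfix : conjH1 κ.kerSubgroup (geomTorsion W (p : ℤ)) γ x = x := by
    apply hinj
    rw [← conjH1_torsionToPrimaryH1Sub, hx, hfix]
  -- descent to `ℚ`
  obtain ⟨y, hy⟩ := ZpDescent.exists_resSubgroup_eq_of_conjH1_eq hγ hstab hpM x hxfix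
  -- the certificate kills `y`
  have hy0 : y = 0 := hcert κ hκ y (by rw [hy, hx]; exact hs)
  rw [← hx, ← hy, hy0, map_zero, map_zero]

/-- **THE ♯0 THEOREM — `R♯(E,p) = 0 ⟹ Sel₀(ℚ_∞, E[p^∞]) = 0`** (`Rank1Residual.FineSelmerTrivialAt W p`), for
`E/ℚ` with `E[p]` irreducible and `ρ̄_{E,p}` not surjective: descent half (this file) + Nakayama half
(`…SharpNakayama`).  PROVED, no named fact; the certificate `hcert` is the per-pair input.
[cite: GreenbergLNM1716, §3 Lemmas 3.1–3.2 and §1 p. 60] [cite: CoatesSujatha2005, §3 statement (A)] -/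
theorem fineSelmerTrivialAt_of_irr_of_not_surj_of_sharpResidual_eq_zero
    (hirr : W.HasIrreducibleModPGaloisRep p) (hns : ¬ W.HasSurjectiveModNGaloisRep p)
    (hcert : ∀ κ : ZpExtension ℚ p, κ.IsCyclotomic →
      ∀ y : discreteH1 (absoluteGaloisGroup ℚ) (geomTorsion W (p : ℤ)),
        W.torsionToPrimaryH1Sub p κ.kerSubgroup
            (ResKernel.resSubgroup κ.kerSubgroup (geomTorsion W (p : ℤ)) y) ∈ W.fineSelmerInfty κ →
          y = 0) :
    FineSelmerTrivialAt W p :=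
  fineSelmerTrivialAt_of_forall_pTorsion_fixed_eq_zero W p
    (forall_pTorsion_fixed_eq_zero_of_sharpResidual_eq_zero W p hirr hns hcert)

/-- **THE ♯0 THEOREM, (A)-form — `R♯(E,p) = 0 ⟹` Coates–Sujatha's statement (A) at the pair**
(`Rank1Residual.ConjAAt W p`, the conclusion of `FineMu.stub_conjA_three` for THIS `W`), for `E/ℚ` with `E[p]`
irreducible and `ρ̄_{E,p}` not surjective.  PROVED, no named fact; (A) is asserted for no curve (the certificate is
the hypothesis).  This REPLACES, on the small-image locus, Deo–Ray–Sujatha's Thm. 3.9 whose local hypothesis (c3)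
fails on U3. [cite: CoatesSujatha2005, §3 statement (A)] [cite: DeoRaySujatha2023, Thm. 3.9 and §3 (c3)]
[cite: GreenbergLNM1716, §3 Lemmas 3.1–3.2] -/
theorem conjAAt_of_irr_of_not_surj_of_sharpResidual_eq_zero
    (hirr : W.HasIrreducibleModPGaloisRep p) (hns : ¬ W.HasSurjectiveModNGaloisRep p)
    (hcert : ∀ κ : ZpExtension ℚ p, κ.IsCyclotomic →
      ∀ y : discreteH1 (absoluteGaloisGroup ℚ) (geomTorsion W (p : ℤ)),
        W.torsionToPrimaryH1Sub p κ.kerSubgroup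
            (ResKernel.resSubgroup κ.kerSubgroup (geomTorsion W (p : ℤ)) y) ∈ W.fineSelmerInfty κ →
          y = 0) :
    ConjAAt W p :=
  (fineSelmerTrivialAt_of_irr_of_not_surj_of_sharpResidual_eq_zero W p hirr hns hcert).conjAAt

/-- `μ`-form: `R♯(E,p) = 0 ⟹` pointwise `μ(X₀(E/ℚ_∞)) = 0` (`Rank1Residual.FineMuZeroAt W p`).  PROVED.
[cite: CoatesSujatha2005, §3 statement (A), `μ`-form] [cite: GreenbergLNM1716, §3 Lemmas 3.1–3.2] -/
theorem fineMuZeroAt_of_irr_of_not_surj_of_sharpResidual_eq_zero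
    (hirr : W.HasIrreducibleModPGaloisRep p) (hns : ¬ W.HasSurjectiveModNGaloisRep p)
    (hcert : ∀ κ : ZpExtension ℚ p, κ.IsCyclotomic →
      ∀ y : discreteH1 (absoluteGaloisGroup ℚ) (geomTorsion W (p : ℤ)),
        W.torsionToPrimaryH1Sub p κ.kerSubgroup
            (ResKernel.resSubgroup κ.kerSubgroup (geomTorsion W (p : ℤ)) y) ∈ W.fineSelmerInfty κ →
          y = 0) :
    FineMuZeroAt W p :=
  (fineSelmerTrivialAt_of_irr_of_not_surj_of_sharpResidual_eq_zero W p hirr hns hcert).fineMuZeroAt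

end OverQ

/-! ### §4 On the route's domain `ClassX11a W p ∧ ¬ Surj W p` (U3 at `p = 3`, U5 at `p = 5`) -/

/-- **♯0 door on the finemu3/finemu5 domain**: at a NON-SURJECTIVE X11a pair, the level-0 certificate
«`R♯(E,p) = 0`» gives statement (A) at the pair (`Irr` is read off `ClassX11a`).  PROVED, no named fact; nothing
asserted about any curve. [cite: CoatesSujatha2005, §3 statement (A)] [cite: DeoRaySujatha2023, Thm. 3.9 (the road it replaces on U3)] -/
theorem _root_.Summit.BirchSwinnertonDyer.Rank1Residual.ClassX11a.conjAAt_of_not_surj_of_sharpResidual_eq_zero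
    (W : WeierstrassCurve ℚ) [W.IsElliptic] [W.IsGloballyMinimal] (p : ℕ) [Fact p.Prime]
    (hX : ClassX11a W p) (hns : ¬ Surj W p)
    (hcert : ∀ κ : ZpExtension ℚ p, κ.IsCyclotomic →
      ∀ y : discreteH1 (absoluteGaloisGroup ℚ) (geomTorsion W (p : ℤ)),
        W.torsionToPrimaryH1Sub p κ.kerSubgroup
            (ResKernel.resSubgroup κ.kerSubgroup (geomTorsion W (p : ℤ)) y) ∈ W.fineSelmerInfty κ →
          y = 0) :
    ConjAAt W p :=
  conjAAt_of_irr_of_not_surj_of_sharpResidual_eq_zero W p hX.irr hns hcert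

end Summit.BirchSwinnertonDyer.BirchSwinnertonDyer.Theorems.UpperNonSurjThreeSharp

end
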